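import Literature.Analysis.FluidPDE.SerrinEnstrophyGronwall
import Literature.Analysis.FluidPDE.EnstrophySplittingDissipation
import Literature.Analysis.FluidPDE.WholeSpaceIBPIntegrable

/-!
# Crux `HodographBetchov.ClassBudgetsRegularise` (stmt-NavierStokesRegularity-16863), line `birth` —
# the transport term of the enstrophy balance vanishes (helper for stub 1)

For a `C³` divergence-free, bounded field `v` on `ℝ³` with `Dv, D²v ∈ L²`, the transport part of
the cubic term of the enstrophy balance vanishes:

  `∫ Σᵢ ⟪∂ᵢv, D(∂ᵢv)(v)⟫ = ½ ∫ ⟪v, ∇|∇v|²_F⟫ = −½ ∫ (div v) |∇v|²_F = 0`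

(`integral_sum_inner_fderiv_transport_eq_zero`, by the `L¹` integration by parts
`integral_mul_divergence_add_eq_zero_of_integrable` of the tree). Used by the enstrophy production
identity (`HodographBetchovClassBudgetsRegulariseProduction.lean`).

References: P. G. Lemarié-Rieusset, *The Navier–Stokes Problem in the 21st Century* (2016),
(7.20), (11.9); A. J. Majda, A. L. Bertozzi, *Vorticity and Incompressible Flow* (2002), §1.2.
-/

noncomputable section

open MeasureTheory Set Function Filter Topology InnerProductSpace
open scoped ENNReal NNReal ContDiff RealInnerProductSpace Laplacian

-- the summit and its single sub-problem share the name (CONVENTIONS §1), as in every Theorems file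
set_option linter.dupNamespace false

namespace Summit.NavierStokesRegularity.NavierStokesRegularity.Theorems.ClassBudgetsRegularise

open Literature.Analysis Literature.Analysis.FluidPDE

/-- **The transport term vanishes**: for `v ∈ C³` divergence free and bounded with `Dv, D²v ∈ L²`,
`∫ Σᵢ ⟪∂ᵢv, D(∂ᵢv)(v)⟫ = ½ ∫ ⟪v, ∇|∇v|²_F⟫ = 0` (integration by parts against `div v = 0`).
[folklore] -/
theorem integral_sum_inner_fderiv_transport_eq_zero
    {v : EuclideanSpace ℝ (Fin 3) → EuclideanSpace ℝ (Fin 3)} (hv : ContDiff ℝ 3 v)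
    (hdiv : VectorCalculus.IsDivFree v) {B : ℝ} (hB : ∀ x, ‖v x‖ ≤ B)
    (hv1 : ∫⁻ x, ‖iteratedFDeriv ℝ 1 v x‖ₑ ^ 2 < ⊤) (hv2 : ∫⁻ x, ‖iteratedFDeriv ℝ 2 v x‖ₑ ^ 2 < ⊤) :
    ∫ x, ∑ i, ⟪fderiv ℝ v x (EuclideanSpace.basisFun (Fin 3) ℝ i),
        fderiv ℝ (fun y => fderiv ℝ v y (EuclideanSpace.basisFun (Fin 3) ℝ i)) x (v x)⟫ = 0 := by
  set e := EuclideanSpace.basisFun (Fin 3) ℝ with he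
  have he1 : ∀ i, ‖e i‖ = 1 := fun i => by simp [he]
  have hB0 : 0 ≤ B := (norm_nonneg _).trans (hB 0)
  have hv2' : ContDiff ℝ 2 v := hv.of_le (by norm_num)
  have hv1' : ContDiff ℝ 1 v := hv.of_le (by norm_num)
  -- the slices `fᵢ = ∂ᵢ v` (each `C²`) and `θ = Σᵢ ‖fᵢ‖²`
  set f : Fin 3 → EuclideanSpace ℝ (Fin 3) → EuclideanSpace ℝ (Fin 3) :=
    fun i y => fderiv ℝ v y (e i) with hf
  have hf2 : ∀ i, ContDiff ℝ 2 (f i) := fun i =>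
    (hv.fderiv_right (m := 2) (by norm_num)).clm_apply contDiff_const
  have hf1 : ∀ i, ContDiff ℝ 1 (f i) := fun i => (hf2 i).of_le (by norm_num)
  set θ : EuclideanSpace ℝ (Fin 3) → ℝ := fun y => ∑ i, ‖f i y‖ ^ 2 with hθ
  have hθ1 : ContDiff ℝ 1 θ := ContDiff.sum fun i _ => (hf1 i).norm_sq ℝ
  have hdiv' : ∀ x, VectorCalculus.divergence v x = 0 := hdiv
  -- the derivative of `θ` along `v x`
  have hDθ : ∀ x, fderiv ℝ θ x (v x) = 2 * ∑ i, ⟪f i x, fderiv ℝ (f i) x (v x)⟫ := by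
    intro x
    have hdiff : ∀ i, DifferentiableAt ℝ (fun y => ‖f i y‖ ^ 2) x := fun i =>
      (((hf1 i).differentiable one_ne_zero) x).norm_sq ℝ
    have hdi : ∀ i, fderiv ℝ (fun y => ‖f i y‖ ^ 2) x (v x) = 2 * ⟪f i x, fderiv ℝ (f i) x (v x)⟫ := by
      intro i
      rw [(((hf1 i).differentiable one_ne_zero) x).hasFDerivAt.norm_sq.fderiv]
      simp [two_mul]
    have hθ' : θ = fun y => ∑ i, ‖f i y‖ ^ 2 := rfl
    rw [hθ', fderiv_fun_sum fun i _ => hdiff i, FunLike.coe_sum, Finset.sum_apply, Finset.mul_sum]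
    exact Finset.sum_congr rfl fun i _ => hdi i
  -- continuity and `L²` bounds
  have cv : Continuous v := hv.continuous
  have cf : ∀ i, Continuous (f i) := fun i => (hf1 i).continuous
  have cDf : ∀ i, Continuous fun x => fderiv ℝ (f i) x (v x) := fun i =>
    ((hf1 i).continuous_fderiv one_ne_zero).clm_apply cv
  have n_f : ∀ i x, ‖f i x‖ ≤ ‖iteratedFDeriv ℝ 1 v x‖ := fun i x => norm_fderiv_apply_basisFun_le v x i
  have n_Df : ∀ i x, ‖fderiv ℝ (f i) x (v x)‖ ≤ ‖B • iteratedFDeriv ℝ 2 v x‖ := by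
    intro i x
    rw [norm_smul, Real.norm_of_nonneg hB0]
    have hfi : ‖fderiv ℝ (f i) x‖ ≤ ‖iteratedFDeriv ℝ 2 v x‖ := by
      rw [← norm_iteratedFDeriv_zero (𝕜 := ℝ) (f := fderiv ℝ (f i)), norm_iteratedFDeriv_fderiv]
      exact norm_iteratedFDeriv_fderiv_apply_basisFun_le hv 1 (by norm_num) x i
    calc ‖fderiv ℝ (f i) x (v x)‖ ≤ ‖fderiv ℝ (f i) x‖ * ‖v x‖ := (fderiv ℝ (f i) x).le_opNorm _
      _ ≤ ‖iteratedFDeriv ℝ 2 v x‖ * B := mul_le_mul hfi (hB x) (norm_nonneg _) (norm_nonneg _)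
      _ = B * ‖iteratedFDeriv ℝ 2 v x‖ := mul_comm _ _
  have l2f : ∀ i, ∫⁻ x, ‖f i x‖ₑ ^ 2 < ⊤ := fun i => lintegral_enorm_sq_lt_top_of_norm_le (n_f i) hv1
  have l2B2 : ∫⁻ x, ‖B • iteratedFDeriv ℝ 2 v x‖ₑ ^ 2 < ⊤ := lintegral_enorm_sq_const_smul_lt_top B hv2
  have l2Df : ∀ i, ∫⁻ x, ‖fderiv ℝ (f i) x (v x)‖ₑ ^ 2 < ⊤ := fun i =>
    lintegral_enorm_sq_lt_top_of_norm_le (n_Df i) l2B2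
  -- integrability of `θ v`, `θ div v = 0`, `⟪v, ∇θ⟫`
  have i_f2 : ∀ i, Integrable (fun x => ‖f i x‖ ^ 2) volume := fun i =>
    FluidPDE.integrable_sq_norm_of_lintegral_lt_top (cf i) (l2f i)
  have iθ : Integrable θ volume := by
    have : θ = fun x => ∑ i, ‖f i x‖ ^ 2 := rfl
    rw [this]; exact integrable_finsetSum _ fun i _ => i_f2 i
  have hθ0 : ∀ x, 0 ≤ θ x := fun x => Finset.sum_nonneg fun i _ => sq_nonneg _
  have hint : Integrable (fun x => θ x • v x) volume := by
    refine Integrable.mono' (iθ.norm.mul_const B) ((hθ1.continuous.smul cv).aestronglyMeasurable)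
      (Eventually.of_forall fun x => ?_)
    rw [norm_smul]
    exact mul_le_mul_of_nonneg_left (hB x) (norm_nonneg _)
  have h₁ : Integrable (fun x => θ x * VectorCalculus.divergence v x) volume := by
    have : (fun x => θ x * VectorCalculus.divergence v x) = fun _ => 0 := by
      funext x; rw [hdiv' x, mul_zero]
    rw [this]; exact integrable_zero _ _ _
  have ipair : ∀ i, Integrable (fun x => ⟪f i x, fderiv ℝ (f i) x (v x)⟫) volume := fun i =>
    integrable_of_norm_le_mul_of_lintegral_sq ((cf i).inner (cDf i)).aestronglyMeasurable (cf i)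
      (cDf i) (l2f i) (l2Df i) fun x => norm_inner_le_norm _ _
  have hgradθ : ∀ x, ⟪v x, gradient θ x⟫ = fderiv ℝ θ x (v x) := by
    intro x
    rw [real_inner_comm, gradient, InnerProductSpace.toDual_symm_apply]
  have h₂ : Integrable (fun x => ⟪v x, gradient θ x⟫) volume := by
    have : (fun x => ⟪v x, gradient θ x⟫) = fun x => 2 * ∑ i, ⟪f i x, fderiv ℝ (f i) x (v x)⟫ := by
      funext x; simp only [hgradθ, hDθ]
    rw [this]
    exact (integrable_finsetSum _ fun i _ => ipair i).const_mul 2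
  -- integration by parts: `∫ θ div v + ∫ ⟪v, ∇θ⟫ = 0`
  have key := integral_mul_divergence_add_eq_zero_of_integrable hθ1 hv1' hint h₁ h₂
  have h0 : ∫ x, θ x * VectorCalculus.divergence v x = 0 := by
    simp_rw [hdiv', mul_zero, integral_zero]
  rw [h0, zero_add] at key
  have h2 : ∫ x, ⟪v x, gradient θ x⟫ = 2 * ∫ x, ∑ i, ⟪f i x, fderiv ℝ (f i) x (v x)⟫ := by
    rw [← integral_const_mul]
    refine integral_congr_ae (Eventually.of_forall fun x => ?_)
    simp only [hgradθ, hDθ]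
  rw [h2] at key
  have : ∫ x, ∑ i, ⟪f i x, fderiv ℝ (f i) x (v x)⟫ = 0 := by linarith
  simpa [hf] using this


/-- **The transport term vanishes, registered helper-stub form.** [folklore] -/
theorem transport_term_vanishes :
    ∀ (v : EuclideanSpace ℝ (Fin 3) → EuclideanSpace ℝ (Fin 3)), ContDiff ℝ 3 v →
      VectorCalculus.IsDivFree v → (∃ B : ℝ, ∀ x, ‖v x‖ ≤ B) →
      (∫⁻ x, ‖iteratedFDeriv ℝ 1 v x‖ₑ ^ 2 < ⊤) → (∫⁻ x, ‖iteratedFDeriv ℝ 2 v x‖ₑ ^ 2 < ⊤) →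
      ∫ x, ∑ i, inner ℝ (fderiv ℝ v x (EuclideanSpace.basisFun (Fin 3) ℝ i))
          (fderiv ℝ (fun y => fderiv ℝ v y (EuclideanSpace.basisFun (Fin 3) ℝ i)) x (v x)) = 0 := by
  intro v hv hdiv hB hv1 hv2
  obtain ⟨B, hB⟩ := hB
  exact integral_sum_inner_fderiv_transport_eq_zero hv hdiv hB hv1 hv2

end Summit.NavierStokesRegularity.NavierStokesRegularity.Theorems.ClassBudgetsRegularise

end
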